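import Summits.CriticalPhenomena.PercolationContinuityZ3.Theorems.PercNearOneGluingNoHeavyQuantThreeRelaySiblings
import HarnessLib

/-!
# QUANT lane R8, T-DEC: THE 3-CHAIN `R[q](R[p](R[s]))` UNDER THE HULL + HIGH CRITERION — hull+high decomposable at every floor `x ≤ qps`
# exactly when (high floors) `(1−p)·x·(1−m+2x) ≤ p(1−s)(m−2x)(1−x)`; condition C1 of `hullHigh_three` holds for every 3-chain

builds on p205010 (kernel theorem, internal audit signed; external expert review pending)

Support file (`--supports stmt-CriticalPhenomena-4575`), QUANT lane seat prim-quant-census-1 (gen 29); memo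
`run/shared/lean/prim/quant/prim-quant-census-1/g29/HULLHIGH-G29.md` §5.  Theorems only, standard axioms, no sorries.  Over census-1 g29's
`…QuantThreeRelaySiblings` (`hullHigh_three`: the closed-form certificate for laws on `{0,1,2,3}` with mean `> 2`).

The gated 3-chain is `(1−q, q(1−p), qp(1−s), qps)` with mean `m = q(1+p+ps)`.  For `m ≤ 2` it has no positive low atom (census-1 g29's
`hullHigh_gate_of_meanTwo`); for `m > 2` the atom `1` is low and `hullHigh_three` applies with `g₂ = 1` at low floors (`2x ≤ m−1`, nothing to check) and with
`g₁ = x`, `g₂ = m − 2x` at high floors, where C1 `q(1−p)(1−m+2x) ≤ (1−q)(m−2x)` holds ALWAYS (`m − 2x ≥ q·u`, `u = 1 + p − ps ≥ 1`, and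
`(1−q)u − (1−p)(1−qu) = (u−1)(1−pq) + p(1−q) ≥ 0`) and C2 becomes the explicit hypothesis `(1−p)·x·(1−m+2x) ≤ p(1−s)·(m−2x)·(1−x)`: it holds for a light
grandchild and fails for a near-sure grandchild under a lighter child (`s → 1`: the glued-child / far-giant corner of memo §0 (5)–(6); census: 3-chains 96.9 %).
* `chain3_rho_apply`; **`hullHigh_chain3`** (high floors, C2 as hypothesis); **`hullHigh_chain3_of_floor`** (every floor `x ≤ qps`; C2 only demanded when `2x ≥ m − 1`).

HONEST STATUS.  Family criterion; `SiblingStep` ⟺ `GateStepN`, `UPartStep`, `LightResidDECOracle`, `FarTreeRow` OPEN; RATE class (log\*) / honest sentence of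
`run/shared/lean/prim/quant/README.md` unchanged.  [this work].  Nothing here is cited as a published result.  The gluing rows served
[cite: KozmaNitzan2024, Conjecture 3 (p. 15)]; product measure [cite: Grimmett1999, §1.3 p. 10].
-/

noncomputable section

open scoped BigOperators

namespace Summit.CriticalPhenomena.PercolationContinuityZ3.Theorems
namespace Quant
namespace LawDec

open Finset

/-- the point mass `δ_K` -/
local notation3 "δ[" K "]" => (fun k : ℕ => if k = (K : ℕ) then (1 : ℝ) else 0)

/-- the 2-chain sub-forest law `ρ₂[s] = δ₁ ∗ gate_s δ₁` -/
local notation3 "ρ₂[" s "]" => lconv 1 1 (fun k : ℕ => if k = (1 : ℕ) then (1 : ℝ) else 0)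
  (gate (fun k : ℕ => if k = (1 : ℕ) then (1 : ℝ) else 0) s)

/-- the 3-chain sub-forest law `ρ₃[p, s] = δ₁ ∗ gate_p (δ₁ ∗ gate_s δ₁)` (root relay, child relay at gate `p`, grandchild at gate `s`) -/
local notation3 "ρ₃[" p ", " s "]" => lconv 1 2 (fun k : ℕ => if k = (1 : ℕ) then (1 : ℝ) else 0) (gate (ρ₂[s]) p)

/-- the atoms of the 3-chain sub-forest law: `(0, 1−p, p(1−s), ps)`. [this work] -/
theorem chain3_rho_apply (p s : ℝ) (h : ℕ) :
    (ρ₃[p, s]) h = (if h = 1 then 1 - p else 0) + (if h = 2 then p * (1 - s) else 0) + (if h = 3 then p * s else 0) := by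
  rcases Nat.lt_or_ge h 4 with hlt | hge
  · interval_cases h
    · norm_num [lconv, Finset.sum_range_succ, gate_apply]
    · norm_num [lconv, Finset.sum_range_succ, gate_apply]
    · norm_num [lconv, Finset.sum_range_succ, gate_apply]
    · norm_num [lconv, Finset.sum_range_succ, gate_apply]
  · rw [if_neg (by omega), if_neg (by omega), if_neg (by omega), add_zero, add_zero]
    simp only [lconv, gate_apply]
    refine Finset.sum_eq_zero fun i hi => Finset.sum_eq_zero fun k hk => ?_
    rw [Finset.mem_range] at hi hk
    rw [if_neg (by omega)]

/-- **THE 3-CHAIN `R[q](R[p](R[s]))` WITH MEAN `m = q(1+p+ps) > 2` IS HULL + HIGH DECOMPOSABLE at every floor `x ≤ qps` with `2x ≥ m − 1`, PROVIDED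
C2: `(1−p)·x·(1 − m + 2x) ≤ p(1−s)·(m − 2x)·(1 − x)`** (C1 holds for every 3-chain: `m − 2x ≥ q(1+p−ps)` and `(1−p)(1 − q(1+p−ps)) ≤ (1−q)(1+p−ps)`).
C2 fails exactly for a near-sure grandchild under a lighter child (`s → 1`, `p < 1`: the glued-child corner). [this work] -/
theorem hullHigh_chain3 {q p s x : ℝ} (hq0 : 0 < q) (hq1 : q < 1) (hp0 : 0 ≤ p) (hp1 : p ≤ 1) (hs0 : 0 ≤ s) (hs1 : s ≤ 1)
    (hm2 : 2 < q * (1 + p + p * s)) (hx : x ≤ q * p * s) (hxm : q * (1 + p + p * s) - 1 ≤ 2 * x)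
    (C2 : (1 - p) * x * (1 - q * (1 + p + p * s) + 2 * x) ≤ p * (1 - s) * (q * (1 + p + p * s) - 2 * x) * (1 - x)) :
    HullHigh x (q * (1 + p + p * s)) 3 (gate (ρ₃[p, s]) q) := by
  set m : ℝ := q * (1 + p + p * s) with hm
  have app : ∀ h : ℕ, gate (ρ₃[p, s]) q h = q * ((if h = 1 then 1 - p else 0) + (if h = 2 then p * (1 - s) else 0)
      + (if h = 3 then p * s else 0)) + (1 - q) * (if h = 0 then 1 else 0) := by
    intro h; rw [gate_apply, chain3_rho_apply]
  have v0 : gate (ρ₃[p, s]) q 0 = 1 - q := by rw [app]; simp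
  have v1 : gate (ρ₃[p, s]) q 1 = q * (1 - p) := by rw [app]; simp
  have v2 : gate (ρ₃[p, s]) q 2 = q * (p * (1 - s)) := by rw [app]; simp
  have v3 : gate (ρ₃[p, s]) q 3 = q * (p * s) := by rw [app]; simp
  have v4 : ∀ h, 3 < h → gate (ρ₃[p, s]) q h = 0 := fun h hh => by
    rw [app, if_neg (by omega), if_neg (by omega), if_neg (by omega), if_neg (by omega)]; ring
  have hps : p * s ≤ p := mul_le_of_le_one_right hp0 hs1
  have hqp1 : q * p * s ≤ q * p := by rw [mul_assoc]; exact mul_le_mul_of_nonneg_left hps hq0.le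
  have hqp2 : q * p ≤ q := mul_le_of_le_one_right hq0.le hp1
  have hmexp : m = q + q * p + q * p * s := by rw [hm]; ring
  have hm3 : m < 3 := by linarith
  have hxq : x ≤ q := by linarith
  have hx1 : x < 1 := by linarith
  set u : ℝ := 1 + p - p * s with hu
  have hu1 : 1 ≤ u := by rw [hu]; linarith
  have hquexp : q * u = q + q * p - q * p * s := by rw [hu]; ring
  have hqu : q * u ≤ m - 2 * x := by linarith
  have e1 : (m - (m - 2 * x)) / 2 = x := by ring
  have hx3 : 3 * x ≤ m := by linarith
  have hqu0 : 0 < q * u := mul_pos hq0 (by linarith)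
  refine hullHigh_three x m (m - 2 * x) _ (fun h => ?_) v4 ?_ ?_ hm2 hm3 (by linarith) (by linarith) (by linarith)
    (by rw [e1]) (by rw [e1]; exact hx1) ?_ ?_
  · rcases Nat.lt_or_ge h 4 with hlt | hge
    · interval_cases h
      · rw [v0]; linarith
      · rw [v1]; exact mul_nonneg hq0.le (by linarith)
      · rw [v2]; exact mul_nonneg hq0.le (mul_nonneg hp0 (by linarith))
      · rw [v3]; positivity
    · rw [v4 h (by omega)]
  · rw [Finset.sum_range_succ, Finset.sum_range_succ, Finset.sum_range_succ, Finset.sum_range_succ, Finset.sum_range_zero, v0, v1, v2, v3]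
    ring
  · rw [Finset.sum_range_succ, Finset.sum_range_succ, Finset.sum_range_succ, Finset.sum_range_succ, Finset.sum_range_zero, v0, v1, v2, v3]
    push_cast; rw [hm]; ring
  · -- C1: `q(1−p)(1 − m + 2x) ≤ (1−q)(m − 2x)` via `q(1−p)(1 − qu) ≤ (1−q)·q·u`
    rw [v1, v0]
    have hpq1 : p * q ≤ 1 := by have := mul_le_mul hp1 hq1.le hq0.le zero_le_one; linarith
    have k1 : (1 - p) * (1 - q * u) ≤ (1 - q) * u := by
      -- `u(1 − q) − (1 − p)(1 − qu) = (u − 1)(1 − pq) + p(1 − q) ≥ 0`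
      have e : (1 - q) * u - (1 - p) * (1 - q * u) = (u - 1) * (1 - p * q) + p * (1 - q) := by ring
      nlinarith [mul_nonneg (sub_nonneg.2 hu1) (sub_nonneg.2 hpq1), mul_nonneg hp0 (sub_nonneg.2 hq1.le), e]
    have hq1p : 0 ≤ q * (1 - p) := mul_nonneg hq0.le (by linarith)
    have hA : q * (1 - p) * (1 - (m - 2 * x)) ≤ q * (1 - p) * (1 - q * u) :=
      mul_le_mul_of_nonneg_left (by linarith) hq1p
    have hB : q * (1 - p) * (1 - q * u) ≤ q * ((1 - q) * u) := by
      rw [mul_assoc]; exact mul_le_mul_of_nonneg_left k1 hq0.le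
    have hC : q * ((1 - q) * u) ≤ (1 - q) * (m - 2 * x) := by
      have e : q * ((1 - q) * u) = (1 - q) * (q * u) := by ring
      rw [e]; exact mul_le_mul_of_nonneg_left hqu (by linarith)
    linarith
  · -- C2: the hypothesis times `q`
    rw [v1, v2, e1]
    have e2 : q * (1 - p) * x * (1 - (m - 2 * x)) = q * ((1 - p) * x * (1 - m + 2 * x)) := by ring
    have e3 : q * (p * (1 - s)) * (m - 2 * x) * (1 - x) = q * (p * (1 - s) * (m - 2 * x) * (1 - x)) := by ring
    rw [e2, e3]
    exact mul_le_mul_of_nonneg_left C2 hq0.le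

/-- **THE 3-CHAIN AT EVERY FLOOR `x ≤ qps` (`m > 2`)**: low floors (`2x ≤ m − 1`) need nothing; high floors need C2. [this work] -/
theorem hullHigh_chain3_of_floor {q p s x : ℝ} (hq0 : 0 < q) (hq1 : q < 1) (hp0 : 0 ≤ p) (hp1 : p ≤ 1) (hs0 : 0 ≤ s) (hs1 : s ≤ 1)
    (hm2 : 2 < q * (1 + p + p * s)) (hx : x ≤ q * p * s)
    (C2 : q * (1 + p + p * s) - 1 ≤ 2 * x →
      (1 - p) * x * (1 - q * (1 + p + p * s) + 2 * x) ≤ p * (1 - s) * (q * (1 + p + p * s) - 2 * x) * (1 - x)) :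
    HullHigh x (q * (1 + p + p * s)) 3 (gate (ρ₃[p, s]) q) := by
  rcases le_or_gt (q * (1 + p + p * s) - 1) (2 * x) with hhi | hlo
  · exact hullHigh_chain3 hq0 hq1 hp0 hp1 hs0 hs1 hm2 hx hhi (C2 hhi)
  · set m : ℝ := q * (1 + p + p * s) with hm
    have app : ∀ h : ℕ, gate (ρ₃[p, s]) q h = q * ((if h = 1 then 1 - p else 0) + (if h = 2 then p * (1 - s) else 0)
        + (if h = 3 then p * s else 0)) + (1 - q) * (if h = 0 then 1 else 0) := by
      intro h; rw [gate_apply, chain3_rho_apply]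
    have v0 : gate (ρ₃[p, s]) q 0 = 1 - q := by rw [app]; simp
    have v1 : gate (ρ₃[p, s]) q 1 = q * (1 - p) := by rw [app]; simp
    have v2 : gate (ρ₃[p, s]) q 2 = q * (p * (1 - s)) := by rw [app]; simp
    have v3 : gate (ρ₃[p, s]) q 3 = q * (p * s) := by rw [app]; simp
    have v4 : ∀ h, 3 < h → gate (ρ₃[p, s]) q h = 0 := fun h hh => by
      rw [app, if_neg (by omega), if_neg (by omega), if_neg (by omega), if_neg (by omega)]; ring
    have hps : p * s ≤ p := mul_le_of_le_one_right hp0 hs1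
    have hqp1 : q * p * s ≤ q * p := by rw [mul_assoc]; exact mul_le_mul_of_nonneg_left hps hq0.le
    have hqp2 : q * p ≤ q := mul_le_of_le_one_right hq0.le hp1
    have hmexp : m = q + q * p + q * p * s := by rw [hm]; ring
    have hm3 : m < 3 := by linarith
    have C1' : gate (ρ₃[p, s]) q 1 * (1 - 1) ≤ gate (ρ₃[p, s]) q 0 * 1 := by rw [sub_self, mul_zero, mul_one, v0]; linarith
    have C2' : gate (ρ₃[p, s]) q 1 * ((m - 1) / 2) * (1 - 1) ≤ gate (ρ₃[p, s]) q 2 * 1 * (1 - (m - 1) / 2) := by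
      rw [sub_self, mul_zero, mul_one, v2]
      have : 0 ≤ 1 - (m - 1) / 2 := by linarith
      exact mul_nonneg (mul_nonneg hq0.le (mul_nonneg hp0 (by linarith))) this
    refine hullHigh_three x m 1 _ (fun h => ?_) v4 ?_ ?_ hm2 hm3 (by linarith) zero_lt_one le_rfl (by linarith) (by linarith) C1' C2'
    · rcases Nat.lt_or_ge h 4 with hlt | hge
      · interval_cases h
        · rw [v0]; linarith
        · rw [v1]; exact mul_nonneg hq0.le (by linarith)
        · rw [v2]; exact mul_nonneg hq0.le (mul_nonneg hp0 (by linarith))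
        · rw [v3]; positivity
      · rw [v4 h (by omega)]
    · rw [Finset.sum_range_succ, Finset.sum_range_succ, Finset.sum_range_succ, Finset.sum_range_succ, Finset.sum_range_zero, v0, v1, v2, v3]
      ring
    · rw [Finset.sum_range_succ, Finset.sum_range_succ, Finset.sum_range_succ, Finset.sum_range_succ, Finset.sum_range_zero, v0, v1, v2, v3]
      push_cast; rw [hm]; ring

end LawDec
end Quant
end Summit.CriticalPhenomena.PercolationContinuityZ3.Theorems
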